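import Summits.ResolutionOfSingularities.ResolutionOfSingularities.Theorems.WildConesClassicalRegimes

/-!
# [OURS · L1 W4.6, rung (ii) at p = 2] Threefold hypersurface double points in characteristic two:
# the Milnor number is a strictly decreasing invariant of the point-blow-up procedure in the forced
# regime — one-step drop, termination over EVERY field of characteristic 2, and an effective bound

Cell res-hironaka (LADDER-RESOLUTION rung L, D-0089), slot W4.6 «restricted regimes as rungs», seat
res-L1-s46-pv-4: «(ii) THREEFOLD HYPERSURFACES, second prover: the p = 2 hyperbolic-splitting regime of
`ClassicalRegimes` (n ≥ 3, order-2 cleaned states) as the disjoint strategy». Host: route `WildCones`,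
crux `ClassicalRegimes` (stmt-ResolutionOfSingularities-16884, proved: `WildCones.ClassicalRegimes_proof`).

HONEST FRAMING. Everything here is OURS: theorems about the route's own TYPED point-blow-up dynamics
(`Theorems/WildConesClassicalRegimesDefs.lean`: a state is the coefficient function `c` of
`a = Σ c(A) u^A`, the atom is the hypersurface `z^p = a(u₁,…,uₙ)`; `step` = blow up the closed point,
chart `u_i`, divide by `u_i^p`, translate, delete `p`-th powers; `Isol` = finite Milnor algebra,
`MultP` = cleaned order `≥ p`, `OrdP` = a cleaned monomial of degree `p`, `mu` = `dim_κ κ⟦u⟧/(∂a)`).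
It REPLACES THE ROLE of Th. 16.6 (2) Eq. (127) (H. Hironaka, ms. 2017-03-23, p.84 l.10–20: strict
lexicographic decrease of the résumé's `Inv`-string under a permissible blow-up) and of Th. 16.13
(p.87 l.26–30: «repeatedly but finitely many times») in ONE restricted regime — threefold hypersurface
double points `z² = a(u₁,u₂,u₃)` in the FORCED regime (every state an isolated double point, where any
centre rule must blow up the closed point) — with OUR OWN invariant, the Milnor number. NOTHING here
is a statement of the manuscript [Hironaka2017] and nothing of it is used; no FACT-LIST premise is used
(the hyperbolic splitting of Greuel–Pfister is a kernel theorem of the tree,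
`MuDropCharTwoOrdP.series_drop`). AI review is weaker than expert review.

WHAT IS NEW relative to the landed crux (`Theorems/WildConesClassicalRegimes.lean`, line `milnor-descent`):
* the `p = 2` branch holds over EVERY field of characteristic `2` and for EVERY `n` — the
  `[PerfectField κ]` and `3 ≤ n` binders of `mu_lt_of_infRun_charTwo` / `ClassicalRegimes` are not
  needed for the Milnor descent (`muDrop_two`, `not_infRun_two`); the faithful GEOMETRIC reading of the
  dynamics (cleaning = the coordinate change `z ↦ z + √c·u^A`) is the perfect-field one of the crux;
* `mu_pos`: a state of multiplicity `p ≥ 2` with finite Milnor algebra has `μ ≥ 1` (any characteristic);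
* the EFFECTIVE form (the campaign's «hence terminates» with a number): a run has at most `μ(c₀)`
  consecutive forced double states (`forcedPrefix_lt_mu`, `exists_exit_le_mu`);
* the rung-(ii) face `n = 3` (`threefold_*`), incl. the regime lemma: over a perfect field a forced
  double state of `z² = a(u₁,u₂,u₃)` with a forced double successor is ORDER-2 CLEANED (`OrdP`) — the
  forced double regime IS the hyperbolic-splitting regime (`threefold_ordTwo_of_forcedSuccessor`).

References: G.-M. Greuel, G. Pfister, The splitting lemma in any characteristic, J. Algebra (2026),
Thm 3.5 / Cor 3.7 [GreuelPfister2026] (through the tree's `series_drop`); H. Hironaka, ms. 2017, Th. 16.6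
p.84, Th. 16.13 p.87 — quoted for the ROLE replaced only, under adjudication, not cited as fact.
-/

noncomputable section

-- single-problem summit: the doubled namespace component `ResolutionOfSingularities` is forced
set_option linter.dupNamespace false

open scoped BigOperators Classical

namespace Summit.ResolutionOfSingularities.ResolutionOfSingularities.Theorems

namespace CampaignW46.ThreefoldsCharTwo

open WildCones

/-! ## `μ ≥ 1` at a singular state (any characteristic) -/

/-- [OURS · L1 W4.6] The Jacobian ideal of a state of multiplicity `p ≥ 2` lies in the kernel of the
constant-coefficient map: every `∂a/∂u_i` has zero constant term, because the cleaned series has no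
monomial of degree `1 < p`. [folklore] -/
theorem jac_le_ker_constantCoeff {p n : ℕ} (hp : 2 ≤ p) {κ : Type} [Field κ]
    {c : (Fin n → ℕ) → κ} (hM : MultP p n κ c) :
    jac p n κ c ≤ RingHom.ker (MvPowerSeries.constantCoeff (σ := Fin n) (R := κ)) := by
  unfold jac
  rw [Ideal.span_le]
  rintro _ ⟨i, rfl⟩
  rw [SetLike.mem_coe, RingHom.mem_ker, ← MvPowerSeries.coeff_zero_eq_constantCoeff_apply,
    MvPowerSeries.coeff_apply]
  show ((((0 : Fin n →₀ ℕ) i) + 1 : ℕ) : κ) * ser p n κ c ((0 : Fin n →₀ ℕ) + Finsupp.single i 1) = 0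
  have h0 : clean p n κ c ⇑(Finsupp.single i 1) = 0 := by
    by_contra h
    have hle := hM.2 _ h
    have hsum : Finset.sum Finset.univ (fun j => (Finsupp.single i 1 : Fin n →₀ ℕ) j) = 1 := by
      rw [← Finsupp.sum_fintype (Finsupp.single i 1) (fun _ m => m) (fun _ => rfl)]
      simp
    omega
  have hser : ser p n κ c ((0 : Fin n →₀ ℕ) + Finsupp.single i 1) = 0 := by
    rw [zero_add]
    exact h0
  rw [hser, mul_zero]

/-- [OURS · L1 W4.6] **`μ ≥ 1` at a singular state**: if the cleaned state has multiplicity `p ≥ 2`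
(`MultP`) and finite Milnor algebra (`Isol`), then `0 < μ = dim_κ κ⟦u⟧/(∂a)` — the Jacobian ideal is a
proper ideal. Any field, any characteristic. [folklore] -/
theorem mu_pos {p n : ℕ} (hp : 2 ≤ p) {κ : Type} [Field κ] {c : (Fin n → ℕ) → κ}
    (hI : Isol p n κ c) (hM : MultP p n κ c) : 0 < mu p n κ c := by
  have hne : jac p n κ c ≠ ⊤ := fun htop =>
    RingHom.ker_ne_top (MvPowerSeries.constantCoeff (σ := Fin n) (R := κ))
      (top_le_iff.mp (htop ▸ jac_le_ker_constantCoeff hp hM))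
  haveI : Nontrivial (MvPowerSeries (Fin n) κ ⧸ jac p n κ c) := Ideal.Quotient.nontrivial_iff.mpr hne
  haveI : Module.Finite κ (MvPowerSeries (Fin n) κ ⧸ jac p n κ c) := hI
  exact Module.finrank_pos

/-! ## Characteristic two, every `n`, every field: the one-step drop and termination -/

/-- [OURS · L1 W4.6, replaces the ROLE of Th. 16.6 (2) Eq. (127) p.84 l.10–20 in this regime; NOT a
statement of the manuscript] **One-step Milnor drop in characteristic two, every `n`, EVERY field**:
whenever a state of `z² = a(u₁,…,uₙ)` and its successor under a point blow-up are both isolated double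
points, `μ` drops strictly. The tree's formal hyperbolic-pair descent `MuDropCharTwoOrdP.series_drop`
through the char-two dictionary `muDrop_two_of_seriesDrop` — no `PerfectField`, no `3 ≤ n`.
[cite: GreuelPfister2026, Thm 3.5 and Cor 3.7] -/
theorem muDrop_two (n : ℕ) (κ : Type) [Field κ] [CharP κ 2] : MuDrop 2 n κ :=
  MuDropCharTwoOrdP.muDrop_two_of_seriesDrop (MuDropCharTwoOrdP.series_drop n)

/-- [OURS · L1 W4.6, replaces the ROLE of Th. 16.13 p.87 l.26–30 («finitely many times») in this regime;
NOT a statement of the manuscript] **No infinite forced double run in characteristic two — every `n`,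
EVERY field of characteristic `2`**: no start state, chart word and translation word make every state
of the point-blow-up dynamics of `z² = a(u)` an isolated double point. (The crux `ClassicalRegimes`
states this over perfect fields; the Milnor descent does not use perfectness.) [folklore] -/
theorem not_infRun_two (n : ℕ) (κ : Type) [Field κ] [CharP κ 2] (c₀ : (Fin n → ℕ) → κ)
    (i : ℕ → Fin n) (t : ℕ → Fin n → κ) : ¬ InfRun 2 n κ c₀ i t := fun hall =>
  no_strictAnti_nat (fun m => mu 2 n κ (run 2 n κ c₀ i t m)) fun m =>
    muDrop_two n κ _ (i m) (t m) (hall m).1 (hall m).2 (hall (m + 1)).1 (hall (m + 1)).2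

/-! ## The effective form: at most `μ(c₀)` consecutive forced double states -/

/-- [OURS · L1 W4.6] Along a prefix of forced double states `μ` falls by at least one per step:
if the states `0, …, M` of the run are isolated double points then `μ(state m) + m ≤ μ(c₀)` for all
`m ≤ M`. [folklore] -/
theorem mu_add_le_of_forcedPrefix {n : ℕ} {κ : Type} [Field κ] [CharP κ 2] (c₀ : (Fin n → ℕ) → κ)
    (i : ℕ → Fin n) (t : ℕ → Fin n → κ) {M : ℕ}
    (hpre : ∀ m ≤ M, Isol 2 n κ (run 2 n κ c₀ i t m) ∧ MultP 2 n κ (run 2 n κ c₀ i t m)) :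
    ∀ m ≤ M, mu 2 n κ (run 2 n κ c₀ i t m) + m ≤ mu 2 n κ c₀ := by
  intro m
  induction m with
  | zero => intro _; simp [run]
  | succ m ih =>
    intro hm
    have hdrop : mu 2 n κ (run 2 n κ c₀ i t (m + 1)) < mu 2 n κ (run 2 n κ c₀ i t m) :=
      muDrop_two n κ _ (i m) (t m) (hpre m (by omega)).1 (hpre m (by omega)).2
        (hpre (m + 1) hm).1 (hpre (m + 1) hm).2
    have := ih (by omega)
    omega

/-- [OURS · L1 W4.6, the campaign's «hence terminates» WITH A NUMBER; NOT a statement of the manuscript]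
**Effective bound**: a run of the point-blow-up dynamics of `z² = a(u₁,…,uₙ)` over any field of
characteristic `2` has at most `μ(c₀)` consecutive forced double states from the start — if the states
`0, …, M` are all isolated double points then `M < μ(c₀)`. [folklore] -/
theorem forcedPrefix_lt_mu {n : ℕ} {κ : Type} [Field κ] [CharP κ 2] (c₀ : (Fin n → ℕ) → κ)
    (i : ℕ → Fin n) (t : ℕ → Fin n → κ) {M : ℕ}
    (hpre : ∀ m ≤ M, Isol 2 n κ (run 2 n κ c₀ i t m) ∧ MultP 2 n κ (run 2 n κ c₀ i t m)) :
    M < mu 2 n κ c₀ := by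
  have hM := mu_add_le_of_forcedPrefix c₀ i t hpre M le_rfl
  have hpos := mu_pos (p := 2) le_rfl (hpre M le_rfl).1 (hpre M le_rfl).2
  omega

/-- [OURS · L1 W4.6; NOT a statement of the manuscript] **Exit within `μ(c₀)` steps**: along every
chart/translation word some state of index `≤ μ(c₀)` is NOT a forced double state (not isolated, or of
multiplicity `< 2`, i.e. the procedure has left the regime — resolved the double point or met a
non-isolated one). [folklore] -/
theorem exists_exit_le_mu {n : ℕ} {κ : Type} [Field κ] [CharP κ 2] (c₀ : (Fin n → ℕ) → κ)
    (i : ℕ → Fin n) (t : ℕ → Fin n → κ) :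
    ∃ m ≤ mu 2 n κ c₀, ¬ (Isol 2 n κ (run 2 n κ c₀ i t m) ∧ MultP 2 n κ (run 2 n κ c₀ i t m)) := by
  by_contra h
  refine lt_irrefl _ (forcedPrefix_lt_mu c₀ i t (M := mu 2 n κ c₀) fun m hm => ?_)
  by_contra h'
  exact h ⟨m, hm, h'⟩

/-! ## Rung (ii) at `p = 2`: threefold hypersurface double points `z² = a(u₁,u₂,u₃)` -/

/-- [OURS · L1 W4.6 rung (ii) at `p = 2`, replaces the ROLE of Th. 16.6 (2) Eq. (127) p.84 l.10–20;
NOT a statement of the manuscript] **Threefold hypersurface double points, one step**: for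
`z² = a(u₁,u₂,u₃)` over any field of characteristic `2`, if a state and its point-blow-up successor are
both isolated double points then `μ(successor) < μ(state)`. [cite: GreuelPfister2026, Thm 3.5 and Cor 3.7] -/
theorem threefold_muDrop (κ : Type) [Field κ] [CharP κ 2] (c : (Fin 3 → ℕ) → κ) (i : Fin 3)
    (τ : Fin 3 → κ) (hI : Isol 2 3 κ c) (hM : MultP 2 3 κ c) (hI' : Isol 2 3 κ (step 2 3 κ i τ c))
    (hM' : MultP 2 3 κ (step 2 3 κ i τ c)) : mu 2 3 κ (step 2 3 κ i τ c) < mu 2 3 κ c :=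
  muDrop_two 3 κ c i τ hI hM hI' hM'

/-- [OURS · L1 W4.6 rung (ii) at `p = 2`, replaces the ROLE of Th. 16.13 p.87 l.26–30; NOT a statement
of the manuscript] **Threefold hypersurface double points, termination in the forced regime**: over any
field of characteristic `2` there is no infinite run of the point-blow-up dynamics of `z² = a(u₁,u₂,u₃)`
all of whose states are isolated double points. [folklore] -/
theorem threefold_not_infRun (κ : Type) [Field κ] [CharP κ 2] (c₀ : (Fin 3 → ℕ) → κ)
    (i : ℕ → Fin 3) (t : ℕ → Fin 3 → κ) : ¬ InfRun 2 3 κ c₀ i t :=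
  not_infRun_two 3 κ c₀ i t

/-- [OURS · L1 W4.6 rung (ii) at `p = 2`; NOT a statement of the manuscript] **Threefold hypersurface
double points, effective exit**: along every word the dynamics of `z² = a(u₁,u₂,u₃)` leaves the forced
double regime at some stage `≤ μ(c₀)`. [folklore] -/
theorem threefold_exists_exit_le_mu (κ : Type) [Field κ] [CharP κ 2] (c₀ : (Fin 3 → ℕ) → κ)
    (i : ℕ → Fin 3) (t : ℕ → Fin 3 → κ) :
    ∃ m ≤ mu 2 3 κ c₀, ¬ (Isol 2 3 κ (run 2 3 κ c₀ i t m) ∧ MultP 2 3 κ (run 2 3 κ c₀ i t m)) :=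
  exists_exit_le_mu c₀ i t

/-- [OURS · L1 W4.6 rung (ii) at `p = 2`, the REGIME LEMMA; NOT a statement of the manuscript]
**The forced double regime of a threefold hypersurface is the hyperbolic-splitting regime**: over a
perfect field of characteristic `2`, a forced double state of `z² = a(u₁,u₂,u₃)` whose successor is
again a forced double state is ORDER-2 CLEANED (`OrdP`: the cleaned series has a — necessarily
square-free — quadratic monomial, i.e. a non-zero alternating polar form). A state of cleaned order `3`
exits multiplicity two in one step (`stub_caseAExitOrdSucc`, Case A) and a state of cleaned order `≥ 4`
has no isolated successor (`stub_highOrdNotIsol`). [folklore] -/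
theorem threefold_ordTwo_of_forcedSuccessor (κ : Type) [Field κ] [CharP κ 2] [PerfectField κ]
    (c : (Fin 3 → ℕ) → κ) (i : Fin 3) (τ : Fin 3 → κ) (hM : MultP 2 3 κ c)
    (hI' : Isol 2 3 κ (step 2 3 κ i τ c)) (hM' : MultP 2 3 κ (step 2 3 κ i τ c)) : OrdP 2 3 κ c := by
  by_contra hO
  by_cases hS : OrdPSucc 2 3 κ c
  · exact stub_caseAExitOrdSucc 2 Nat.prime_two 3 le_rfl κ c i τ hM hO hS hI' hM'
  · exact stub_highOrdNotIsol 2 Nat.prime_two 3 (by norm_num) κ c i τ hM hO hS hI'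

/-- [OURS · L1 W4.6 rung (ii) at `p = 2`; NOT a statement of the manuscript] **Every state of a forced
double prefix is order-2 cleaned** (threefold hypersurfaces over a perfect field of characteristic `2`):
if the states `0, …, M + 1` of a run of `z² = a(u₁,u₂,u₃)` are isolated double points, the states
`0, …, M` are order-2 cleaned — the procedure never leaves the hyperbolic-splitting regime before it
leaves the forced double regime. [folklore] -/
theorem threefold_ordTwo_along_forcedPrefix (κ : Type) [Field κ] [CharP κ 2] [PerfectField κ]
    (c₀ : (Fin 3 → ℕ) → κ) (i : ℕ → Fin 3) (t : ℕ → Fin 3 → κ) {M : ℕ}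
    (hpre : ∀ m ≤ M + 1, Isol 2 3 κ (run 2 3 κ c₀ i t m) ∧ MultP 2 3 κ (run 2 3 κ c₀ i t m)) :
    ∀ m ≤ M, OrdP 2 3 κ (run 2 3 κ c₀ i t m) := fun m hm =>
  threefold_ordTwo_of_forcedSuccessor κ _ (i m) (t m) (hpre m (by omega)).2
    (hpre (m + 1) (by omega)).1 (hpre (m + 1) (by omega)).2

end CampaignW46.ThreefoldsCharTwo

end Summit.ResolutionOfSingularities.ResolutionOfSingularities.Theorems

end
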